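import Summits.Ventures.PercRepro.C041TriDomTwoExitCount

/-!
# ROW C-041 — THE TWO-EXIT MARKLESS PIECE, IV: THE CONJECTURE AND THE SIBLING ACROSS THE PIECE
(p6, gen 46; P6-TWOEXIT-LEAN.md §53 ADDENDUM 17)

**THEOREM (TWO-EXIT MARKLESS PIECE)** (`cycDominationS_of_twoExit`, `sibDominationS_of_twoExit`).  Let `K` be a
two-exit markless piece of the status `st` with the exits `f₁ = K–u`, `f₂ = K–v` (`TwoExit`), the marks off `K`.  If
CONJECTURE (STOCHASTIC DOMINATION) holds on `stDel st f₁ f₂` (the exits deleted) and on `stCon st f₁` (the first exit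
contracted — `f₂` is then a chord from `u`'s class to `v`), it holds on `st`; the same for THE SIBLING DOMINATION.
PROOF: THE TWO-EXIT COUNT (`dom_of_twoExit_count`) with THE FIBRE IDENTITY of parts I–II — the classes of `st` are
those of `stCon` when the exits have the same colour (`cyc_same_of_twoExit`, `sib_same_of_twoExit`) and those of
`stDel` otherwise (`cyc_diff_of_twoExit`, `sib_diff_of_twoExit`); the classes of `stCon` ignore the colour of `f₁`
and those of `stDel` the colours of both exits (`cyc_stCon_congr`, `cyc_stDel_congr`, the sibling twins).
READING: an unmarked vertex of degree two, or any markless lobe hanging on two edges, is invisible to the conjecture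
once the two smaller statuses are known — the reduction `C041TriDomTwoExitInduction` iterates it.
-/

namespace PercRepro

namespace ZoneZ

namespace MultiExit

open ZoneData Finset

/-! ## The instances: the conjecture and the sibling across a two-exit markless piece -/

variable {V₁ E₁ U₁ U₂ : Type} (Z₁ : ZoneData V₁ E₁ U₁ U₂) [DecidableEq E₁]
variable {st : E₁ → EStat} {K : Set V₁} {u v : V₁} {f₁ f₂ : E₁}

/-- The crossed classes and `(⊤, ⊥)` of `st` are those of `stCon` on the same-colour colourings. -/
theorem cyc_same_of_twoExit (hT : TwoExit Z₁ st K u v f₁ f₂) (x y z : V₁) (hx : x ∉ K) (hy : y ∉ K) (hz : z ∉ K)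
    (ω : E₁ → Bool) (h : ω f₁ = ω f₂) :
    (CycCrossedS Z₁ x y z st ω ↔ CycCrossedS Z₁ x y z (stCon st f₁) ω) ∧
      (TopBotS Z₁ x y z st ω ↔ TopBotS Z₁ x y z (stCon st f₁) ω) := by
  rw [cycCrossedS_iff, cycCrossedS_iff, topBotS_iff, topBotS_iff, RdS_stCon_iff Z₁ hT ω h hx hy,
    RdS_stCon_iff Z₁ hT ω h hx hz, RdS_stCon_iff Z₁ hT ω h hy hz, MgS_stCon_iff Z₁ hT ω h hx hy,
    MgS_stCon_iff Z₁ hT ω h hx hz, MgS_stCon_iff Z₁ hT ω h hy hz]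
  exact ⟨Iff.rfl, Iff.rfl⟩

/-- The crossed classes and `(⊤, ⊥)` of `st` are those of `stDel` on the mixed colourings. -/
theorem cyc_diff_of_twoExit (hT : TwoExit Z₁ st K u v f₁ f₂) (x y z : V₁) (hx : x ∉ K) (hy : y ∉ K) (hz : z ∉ K)
    (ω : E₁ → Bool) (h : ω f₁ ≠ ω f₂) :
    (CycCrossedS Z₁ x y z st ω ↔ CycCrossedS Z₁ x y z (stDel st f₁ f₂) ω) ∧
      (TopBotS Z₁ x y z st ω ↔ TopBotS Z₁ x y z (stDel st f₁ f₂) ω) := by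
  rw [cycCrossedS_iff, cycCrossedS_iff, topBotS_iff, topBotS_iff, RdS_stDel_iff Z₁ hT ω h hx hy,
    RdS_stDel_iff Z₁ hT ω h hx hz, RdS_stDel_iff Z₁ hT ω h hy hz, MgS_stDel_iff Z₁ hT ω h hx hy,
    MgS_stDel_iff Z₁ hT ω h hx hz, MgS_stDel_iff Z₁ hT ω h hy hz]
  exact ⟨Iff.rfl, Iff.rfl⟩

/-- The classes of `stCon` ignore the colour of `f₁`. -/
theorem cyc_stCon_congr (x y z : V₁) (ω ω' : E₁ → Bool) (h : ∀ e, e ≠ f₁ → ω e = ω' e) :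
    (CycCrossedS Z₁ x y z (stCon st f₁) ω ↔ CycCrossedS Z₁ x y z (stCon st f₁) ω') ∧
      (TopBotS Z₁ x y z (stCon st f₁) ω ↔ TopBotS Z₁ x y z (stCon st f₁) ω') := by
  rw [cycCrossedS_iff, cycCrossedS_iff, topBotS_iff, topBotS_iff, RdS_stCon_congr Z₁ h, MgS_stCon_congr Z₁ h]
  exact ⟨Iff.rfl, Iff.rfl⟩

/-- The classes of `stDel` ignore the colours of the exits. -/
theorem cyc_stDel_congr (x y z : V₁) (ω ω' : E₁ → Bool) (h : ∀ e, ¬ (e = f₁ ∨ e = f₂) → ω e = ω' e) :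
    (CycCrossedS Z₁ x y z (stDel st f₁ f₂) ω ↔ CycCrossedS Z₁ x y z (stDel st f₁ f₂) ω') ∧
      (TopBotS Z₁ x y z (stDel st f₁ f₂) ω ↔ TopBotS Z₁ x y z (stDel st f₁ f₂) ω') := by
  rw [cycCrossedS_iff, cycCrossedS_iff, topBotS_iff, topBotS_iff, RdS_stDel_congr Z₁ h, MgS_stDel_congr Z₁ h]
  exact ⟨Iff.rfl, Iff.rfl⟩

/-- The sibling classes and target of `st` are those of `stCon` on the same-colour colourings. -/
theorem sib_same_of_twoExit (hT : TwoExit Z₁ st K u v f₁ f₂) (x y t : V₁) (hx : x ∉ K) (hy : y ∉ K) (ht : t ∉ K)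
    (ω : E₁ → Bool) (h : ω f₁ = ω f₂) :
    ((SibC₁ Z₁ x y t st ω ∨ SibC₃ Z₁ x y t st ω) ↔
        (SibC₁ Z₁ x y t (stCon st f₁) ω ∨ SibC₃ Z₁ x y t (stCon st f₁) ω)) ∧
      (SibTop Z₁ x y t st ω ↔ SibTop Z₁ x y t (stCon st f₁) ω) := by
  unfold SibC₁ SibC₃ SibTop
  rw [RdS_stCon_iff Z₁ hT ω h hx hy, RdS_stCon_iff Z₁ hT ω h hx ht, RdS_stCon_iff Z₁ hT ω h hy ht,
    MgS_stCon_iff Z₁ hT ω h hx hy, MgS_stCon_iff Z₁ hT ω h hx ht, MgS_stCon_iff Z₁ hT ω h hy ht]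
  exact ⟨Iff.rfl, Iff.rfl⟩

/-- The sibling classes and target of `st` are those of `stDel` on the mixed colourings. -/
theorem sib_diff_of_twoExit (hT : TwoExit Z₁ st K u v f₁ f₂) (x y t : V₁) (hx : x ∉ K) (hy : y ∉ K) (ht : t ∉ K)
    (ω : E₁ → Bool) (h : ω f₁ ≠ ω f₂) :
    ((SibC₁ Z₁ x y t st ω ∨ SibC₃ Z₁ x y t st ω) ↔
        (SibC₁ Z₁ x y t (stDel st f₁ f₂) ω ∨ SibC₃ Z₁ x y t (stDel st f₁ f₂) ω)) ∧
      (SibTop Z₁ x y t st ω ↔ SibTop Z₁ x y t (stDel st f₁ f₂) ω) := by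
  unfold SibC₁ SibC₃ SibTop
  rw [RdS_stDel_iff Z₁ hT ω h hx hy, RdS_stDel_iff Z₁ hT ω h hx ht, RdS_stDel_iff Z₁ hT ω h hy ht,
    MgS_stDel_iff Z₁ hT ω h hx hy, MgS_stDel_iff Z₁ hT ω h hx ht, MgS_stDel_iff Z₁ hT ω h hy ht]
  exact ⟨Iff.rfl, Iff.rfl⟩

/-- The sibling classes of `stCon` ignore the colour of `f₁`. -/
theorem sib_stCon_congr (x y t : V₁) (ω ω' : E₁ → Bool) (h : ∀ e, e ≠ f₁ → ω e = ω' e) :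
    ((SibC₁ Z₁ x y t (stCon st f₁) ω ∨ SibC₃ Z₁ x y t (stCon st f₁) ω) ↔
        (SibC₁ Z₁ x y t (stCon st f₁) ω' ∨ SibC₃ Z₁ x y t (stCon st f₁) ω')) ∧
      (SibTop Z₁ x y t (stCon st f₁) ω ↔ SibTop Z₁ x y t (stCon st f₁) ω') := by
  unfold SibC₁ SibC₃ SibTop
  rw [RdS_stCon_congr Z₁ h, MgS_stCon_congr Z₁ h]
  exact ⟨Iff.rfl, Iff.rfl⟩

/-- The sibling classes of `stDel` ignore the colours of the exits. -/
theorem sib_stDel_congr (x y t : V₁) (ω ω' : E₁ → Bool) (h : ∀ e, ¬ (e = f₁ ∨ e = f₂) → ω e = ω' e) :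
    ((SibC₁ Z₁ x y t (stDel st f₁ f₂) ω ∨ SibC₃ Z₁ x y t (stDel st f₁ f₂) ω) ↔
        (SibC₁ Z₁ x y t (stDel st f₁ f₂) ω' ∨ SibC₃ Z₁ x y t (stDel st f₁ f₂) ω')) ∧
      (SibTop Z₁ x y t (stDel st f₁ f₂) ω ↔ SibTop Z₁ x y t (stDel st f₁ f₂) ω') := by
  unfold SibC₁ SibC₃ SibTop
  rw [RdS_stDel_congr Z₁ h, MgS_stDel_congr Z₁ h]
  exact ⟨Iff.rfl, Iff.rfl⟩

variable [Fintype E₁]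

open Classical in
/-- **CONJECTURE (STOCHASTIC DOMINATION) ACROSS A TWO-EXIT MARKLESS PIECE**: on a status with a two-exit markless
piece `K` (marks off `K`), the conjecture follows from the conjecture on `stDel` (the exits deleted) and on `stCon`
(the first exit contracted). -/
theorem cycDominationS_of_twoExit (hT : TwoExit Z₁ st K u v f₁ f₂) (x y z : V₁) (hx : x ∉ K) (hy : y ∉ K)
    (hz : z ∉ K) (h₀ : CycDominationS Z₁ x y z (stDel st f₁ f₂)) (h₁ : CycDominationS Z₁ x y z (stCon st f₁)) :
    CycDominationS Z₁ x y z st := by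
  intro V hV
  exact dom_of_twoExit_count hT.hne (Src := CycCrossedS Z₁ x y z) (Tgt := TopBotS Z₁ x y z)
    (fun ω h => cyc_same_of_twoExit Z₁ hT x y z hx hy hz ω h)
    (fun ω h => cyc_diff_of_twoExit Z₁ hT x y z hx hy hz ω h)
    (fun ω ω' h => cyc_stCon_congr Z₁ x y z ω ω' h) (fun ω ω' h => cyc_stDel_congr Z₁ x y z ω ω' h) h₀ h₁ V hV

open Classical in
/-- **THE SIBLING DOMINATION ACROSS A TWO-EXIT MARKLESS PIECE**: on a status with a two-exit markless piece `K` (the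
marks and the terminal off `K`), the sibling domination follows from the sibling domination on `stDel` and on
`stCon`. -/
theorem sibDominationS_of_twoExit (hT : TwoExit Z₁ st K u v f₁ f₂) (x y t : V₁) (hx : x ∉ K) (hy : y ∉ K)
    (ht : t ∉ K) (h₀ : SibDominationS Z₁ x y t (stDel st f₁ f₂)) (h₁ : SibDominationS Z₁ x y t (stCon st f₁)) :
    SibDominationS Z₁ x y t st := by
  intro V hV
  have key := dom_of_twoExit_count hT.hne (Src := fun st ω => SibC₁ Z₁ x y t st ω ∨ SibC₃ Z₁ x y t st ω)
    (Tgt := SibTop Z₁ x y t)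
    (fun ω h => sib_same_of_twoExit Z₁ hT x y t hx hy ht ω h)
    (fun ω h => sib_diff_of_twoExit Z₁ hT x y t hx hy ht ω h)
    (fun ω ω' h => sib_stCon_congr Z₁ x y t ω ω' h) (fun ω ω' h => sib_stDel_congr Z₁ x y t ω ω' h)
    (fun V hV => (card_filter_inst.trans_le (h₀ V hV)).trans_eq card_filter_inst)
    (fun V hV => (card_filter_inst.trans_le (h₁ V hV)).trans_eq card_filter_inst) V hV
  exact (card_filter_inst.trans_le key).trans_eq card_filter_inst

end MultiExit

end ZoneZ

end PercRepro
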